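import Summits.Ventures.HodgeRepro0.P5BlockCensusPieces

/-!
# P5BlockCensusDecomp — the block method, continued: the disjoint decomposition and the count, generic over the data

p5 (g21), 2026-08-29.  Supporting artefact (R-5): finite combinatorics only; nothing here is an algebraicity statement.
Companion of `P5BlockCensus.lean` / `P5BlockCensusPieces.lean`.  `balanced_decomposition`: every balanced `S ⊆ U` is the
union of a pairwise-disjoint finset of conjugate pairs and cosets of `H` (the canonical pieces `piecesOf S`: on each
block `cH ∪ −cH` the coset `cH`, or `−cH`, or the pairs `{t, −t}`, `t ∈ cH ∩ S`).  `card_balanced`: the balanced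
subsets of `U` are in bijection with the tuples of allowed pieces, one per block (`cut` / `glue`), so their number is
`∏_i |allowed (crep i)|` — per instance `(2^|H| + 2)^{#blocks}` by a `decide` of each factor.
-/

namespace HodgeRepro0.P5BlockCensus

variable (D : Data)

/-- The canonical pieces of `S` on the block of `crep i`. -/
def blockPieces (S : Finset ℕ) (i : Fin D.creps.length) : Finset (Finset ℕ) :=
  if CosetOn D S (crep D i) then {(coset D (crep D i)).toFinset}
  else if ConjCosetOn D S (crep D i) then {((coset D (crep D i)).map (conj D)).toFinset}
  else ((coset D (crep D i)).toFinset.filter (fun t => t ∈ S)).image (fun t => {t, conj D t})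

/-- The canonical pieces of `S`. -/
def piecesOf (S : Finset ℕ) : Finset (Finset ℕ) := Finset.univ.biUnion (blockPieces D S)

/-- The allowed pieces on the block of `c`. -/
def allowed (c : ℕ) : Finset (Finset ℕ) :=
  (block D c).powerset.filter (fun P => PairsOn D P c ∨ CosetOn D P c ∨ ConjCosetOn D P c)

/-- The balanced subsets of `U`. -/
def balancedSets : Finset (Finset ℕ) := (U D).powerset.filter (Balanced D)

/-- The tuples of allowed pieces, one per block. -/
def pieces : Finset (Fin D.creps.length → Finset ℕ) := Fintype.piFinset (fun i => allowed D (crep D i))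

/-- Cut a set into its block pieces. -/
def cut (S : Finset ℕ) : Fin D.creps.length → Finset ℕ := fun i => S ∩ block D (crep D i)

/-- Glue block pieces. -/
def glue (P : Fin D.creps.length → Finset ℕ) : Finset ℕ := Finset.univ.biUnion P

variable {D}

/-- Elements of the block of `crep i` are coset elements or conjugates of coset elements. -/
theorem mem_block (i : Fin D.creps.length) (x : ℕ) :
    x ∈ block D (crep D i) ↔ x ∈ coset D (crep D i) ∨ ∃ t ∈ coset D (crep D i), x = conj D t := by
  unfold block
  rw [Finset.mem_union, List.mem_toFinset, List.mem_toFinset, List.mem_map]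
  constructor
  · rintro (h | ⟨t, ht, rfl⟩)
    · exact Or.inl h
    · exact Or.inr ⟨t, ht, rfl⟩
  · rintro (h | ⟨t, ht, rfl⟩)
    · exact Or.inl h
    · exact Or.inr ⟨t, ht, rfl⟩

section
variable (hF : Facts D) (hG : Facts2 D)
include hG

/-- Every piece on the block of `crep i` lies in that block. -/
theorem piece_sub_block (S : Finset ℕ) (i : Fin D.creps.length) : ∀ P ∈ blockPieces D S i, P ⊆ block D (crep D i) := by
  intro P hP
  unfold blockPieces at hP
  split_ifs at hP with h1 h2
  · rw [Finset.mem_singleton] at hP; rw [hP]; exact Finset.subset_union_left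
  · rw [Finset.mem_singleton] at hP; rw [hP]; exact Finset.subset_union_right
  · rw [Finset.mem_image] at hP
    obtain ⟨t, ht, rfl⟩ := hP
    have ht' : t ∈ coset D (crep D i) := List.mem_toFinset.mp (Finset.mem_filter.mp ht).1
    intro x hx
    rw [Finset.mem_insert, Finset.mem_singleton] at hx
    rcases hx with rfl | rfl
    · exact (g_block_mem hG i x ht').1
    · exact (g_block_mem hG i t ht').2

/-- Every canonical piece is a conjugate pair or a coset of `H`. -/
theorem pieces_are_pieces (S : Finset ℕ) : ∀ P ∈ piecesOf D S, IsPair D P ∨ IsCoset D P := by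
  intro P hP
  unfold piecesOf at hP
  rw [Finset.mem_biUnion] at hP
  obtain ⟨i, _, hP⟩ := hP
  have hci := g_crep_mem hG i
  unfold blockPieces at hP
  split_ifs at hP with h1 h2
  · rw [Finset.mem_singleton] at hP; rw [hP]
    exact Or.inr ⟨crep D i, (g_conj_units hG _ hci).2, rfl⟩
  · rw [Finset.mem_singleton] at hP; rw [hP]
    exact Or.inr ⟨conj D (crep D i), (g_conj_units hG _ hci).1, g_coset_conj hG _ hci⟩
  · rw [Finset.mem_image] at hP
    obtain ⟨t, ht, rfl⟩ := hP
    have ht' : t ∈ coset D (crep D i) := List.mem_toFinset.mp (Finset.mem_filter.mp ht).1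
    exact Or.inl ⟨t, g_coset_units hG _ hci t ht', rfl⟩

/-- The canonical pieces are pairwise disjoint. -/
theorem pieces_disjoint (S : Finset ℕ) : (piecesOf D S : Set (Finset ℕ)).PairwiseDisjoint id := by
  intro P hP P' hP' hne
  rw [Finset.mem_coe, piecesOf, Finset.mem_biUnion] at hP hP'
  obtain ⟨i, _, hPi⟩ := hP
  obtain ⟨j, _, hPj⟩ := hP'
  by_cases hij : i = j
  · subst hij
    unfold blockPieces at hPi hPj
    split_ifs at hPi hPj with h1 h2
    · rw [Finset.mem_singleton] at hPi hPj; exact absurd (hPi.trans hPj.symm) hne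
    · rw [Finset.mem_singleton] at hPi hPj; exact absurd (hPi.trans hPj.symm) hne
    · rw [Finset.mem_image] at hPi hPj
      obtain ⟨t, ht, rfl⟩ := hPi
      obtain ⟨t', ht', rfl⟩ := hPj
      have htc : t ∈ coset D (crep D i) := List.mem_toFinset.mp (Finset.mem_filter.mp ht).1
      have htc' : t' ∈ coset D (crep D i) := List.mem_toFinset.mp (Finset.mem_filter.mp ht').1
      have htt : t ≠ t' := by rintro rfl; exact hne rfl
      exact g_pair_disj hG i t htc t' htc' htt
  · have h1 := piece_sub_block hG S i P hPi
    have h2 := piece_sub_block hG S j P' hPj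
    show Disjoint P P'
    rw [Finset.disjoint_left]
    intro x hx hx'
    exact g_block_disj hG i j hij x (h1 hx) (h2 hx')

include hF

/-- The canonical pieces of a balanced `S ⊆ U` cover `S` exactly. -/
theorem pieces_union (S : Finset ℕ) (hS : S ⊆ U D) (hb : Balanced D S) : (piecesOf D S).biUnion id = S := by
  ext x
  rw [Finset.mem_biUnion]
  constructor
  · rintro ⟨P, hP, hx⟩
    unfold piecesOf at hP
    rw [Finset.mem_biUnion] at hP
    obtain ⟨i, _, hP⟩ := hP
    have hci := g_crep_mem hG i
    rw [Function.id_def] at hx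
    unfold blockPieces at hP
    split_ifs at hP with h1 h2
    · rw [Finset.mem_singleton] at hP; rw [hP] at hx
      exact (h1 x (List.mem_toFinset.mp hx)).1
    · rw [Finset.mem_singleton] at hP; rw [hP] at hx
      rw [List.mem_toFinset, List.mem_map] at hx
      obtain ⟨t, ht, rfl⟩ := hx
      exact (h2 t ht).2
    · rw [Finset.mem_image] at hP
      obtain ⟨t, ht, rfl⟩ := hP
      obtain ⟨htc, htS⟩ := Finset.mem_filter.mp ht
      have htc' : t ∈ coset D (crep D i) := List.mem_toFinset.mp htc
      have hpairs : PairsOn D S (crep D i) := by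
        rcases (balanced_iff_blocks hF S hS).mp hb (crep D i) hci with h | h | h
        · exact h
        · exact absurd h h1
        · exact absurd h h2
      rw [Finset.mem_insert, Finset.mem_singleton] at hx
      rcases hx with rfl | rfl
      · exact htS
      · exact (hpairs t htc').mp htS
  · intro hx
    obtain ⟨i, hi⟩ := g_block_cover hG x (List.mem_toFinset.mp (hS hx))
    have hci := g_crep_mem hG i
    have hmem : ∀ P ∈ blockPieces D S i, x ∈ P → ∃ P ∈ piecesOf D S, x ∈ id P := by
      intro P hP hxP
      exact ⟨P, Finset.mem_biUnion.mpr ⟨i, Finset.mem_univ i, hP⟩, hxP⟩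
    have hcc := f_creps_mem_coset hF _ hci
    rcases (balanced_iff_blocks hF S hS).mp hb (crep D i) hci with h | h | h
    · have hnc : ¬ CosetOn D S (crep D i) := by
        intro hc
        obtain ⟨a1, a2⟩ := hc (crep D i) hcc
        exact a2 ((h (crep D i) hcc).mp a1)
      have hncc : ¬ ConjCosetOn D S (crep D i) := by
        intro hc
        obtain ⟨a1, a2⟩ := hc (crep D i) hcc
        exact a1 ((h (crep D i) hcc).mpr a2)
      rcases (mem_block i x).mp hi with hxc | ⟨t, ht, rfl⟩
      · apply hmem {x, conj D x}
        · unfold blockPieces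
          rw [if_neg hnc, if_neg hncc, Finset.mem_image]
          exact ⟨x, Finset.mem_filter.mpr ⟨List.mem_toFinset.mpr hxc, hx⟩, rfl⟩
        · simp
      · apply hmem {t, conj D t}
        · unfold blockPieces
          rw [if_neg hnc, if_neg hncc, Finset.mem_image]
          exact ⟨t, Finset.mem_filter.mpr ⟨List.mem_toFinset.mpr ht, (h t ht).mpr hx⟩, rfl⟩
        · simp
    · rcases (mem_block i x).mp hi with hxc | ⟨t, ht, rfl⟩
      · apply hmem (coset D (crep D i)).toFinset
        · unfold blockPieces; rw [if_pos h]; exact Finset.mem_singleton_self _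
        · exact List.mem_toFinset.mpr hxc
      · exact absurd hx (h t ht).2
    · have hnc : ¬ CosetOn D S (crep D i) := by
        intro hc
        exact (hc (crep D i) hcc).2 (h (crep D i) hcc).2
      rcases (mem_block i x).mp hi with hxc | ⟨t, ht, rfl⟩
      · exact absurd hx (h x hxc).1
      · apply hmem ((coset D (crep D i)).map (conj D)).toFinset
        · unfold blockPieces; rw [if_neg hnc, if_pos h]; exact Finset.mem_singleton_self _
        · exact List.mem_toFinset.mpr (List.mem_map.mpr ⟨t, ht, rfl⟩)

/-- THE DECOMPOSITION: every balanced `S ⊆ U` is a DISJOINT UNION of conjugate pairs and cosets of `H`. -/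
theorem balanced_decomposition (S : Finset ℕ) (hS : S ⊆ U D) (hb : Balanced D S) :
    ∃ Ps : Finset (Finset ℕ), (∀ P ∈ Ps, IsPair D P ∨ IsCoset D P) ∧
      (Ps : Set (Finset ℕ)).PairwiseDisjoint id ∧ Ps.biUnion id = S :=
  ⟨piecesOf D S, pieces_are_pieces hG S, pieces_disjoint hG S, pieces_union hF hG S hS hb⟩

/-! ### The count -/

omit hF in
/-- The trichotomy on the block of `crep i` depends only on `S ∩ block`. -/
theorem tri_inter (i : Fin D.creps.length) (S : Finset ℕ) :
    (PairsOn D (S ∩ block D (crep D i)) (crep D i) ↔ PairsOn D S (crep D i)) ∧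
    (CosetOn D (S ∩ block D (crep D i)) (crep D i) ↔ CosetOn D S (crep D i)) ∧
    (ConjCosetOn D (S ∩ block D (crep D i)) (crep D i) ↔ ConjCosetOn D S (crep D i)) := by
  unfold PairsOn CosetOn ConjCosetOn
  refine ⟨?_, ?_, ?_⟩ <;> apply forall_congr' <;> intro t <;> apply imp_congr_right <;> intro ht <;>
    simp [Finset.mem_inter, (g_block_mem hG i t ht).1, (g_block_mem hG i t ht).2]

omit hF in
/-- Membership in a glued set, for a point of the `i`-th block, is membership in the `i`-th piece. -/
theorem mem_glue (P : Fin D.creps.length → Finset ℕ) (hP : P ∈ pieces D) (i : Fin D.creps.length) (t : ℕ)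
    (ht : t ∈ block D (crep D i)) : t ∈ glue D P ↔ t ∈ P i := by
  unfold glue
  rw [Finset.mem_biUnion]
  constructor
  · rintro ⟨j, _, hj⟩
    by_cases hij : j = i
    · rw [← hij]; exact hj
    · exfalso
      have hPj : P j ⊆ block D (crep D j) :=
        Finset.mem_powerset.mp (Finset.mem_filter.mp (Fintype.mem_piFinset.mp hP j)).1
      exact g_block_disj hG j i hij t (hPj hj) ht
  · intro h; exact ⟨i, Finset.mem_univ i, h⟩

/-- `cut` maps balanced sets to tuples of allowed pieces. -/
theorem cut_mem (S : Finset ℕ) (hS : S ∈ balancedSets D) : cut D S ∈ pieces D := by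
  unfold balancedSets at hS
  rw [Finset.mem_filter, Finset.mem_powerset] at hS
  obtain ⟨hSU, hb⟩ := hS
  rw [pieces, Fintype.mem_piFinset]
  intro i
  unfold allowed
  rw [Finset.mem_filter, Finset.mem_powerset]
  refine ⟨Finset.inter_subset_right, ?_⟩
  have h := (balanced_iff_blocks hF S hSU).mp hb (crep D i) (g_crep_mem hG i)
  obtain ⟨h1, h2, h3⟩ := tri_inter hG i S
  unfold cut
  rw [h1, h2, h3]
  exact h

/-- `glue` maps tuples of allowed pieces to balanced sets. -/
theorem glue_mem (P : Fin D.creps.length → Finset ℕ) (hP : P ∈ pieces D) : glue D P ∈ balancedSets D := by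
  have hPi : ∀ i, P i ⊆ block D (crep D i) := fun i =>
    Finset.mem_powerset.mp (Finset.mem_filter.mp (Fintype.mem_piFinset.mp hP i)).1
  have hsub : glue D P ⊆ U D := by
    intro t ht
    unfold glue at ht
    rw [Finset.mem_biUnion] at ht
    obtain ⟨j, _, hj⟩ := ht
    exact g_block_sub_U hG j (hPi j hj)
  unfold balancedSets
  rw [Finset.mem_filter, Finset.mem_powerset]
  refine ⟨hsub, ?_⟩
  rw [balanced_iff_blocks hF _ hsub]
  intro c hc
  obtain ⟨i, rfl⟩ := g_crep_surj hG c hc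
  have htri := (Finset.mem_filter.mp (Fintype.mem_piFinset.mp hP i)).2
  have key : ∀ t ∈ coset D (crep D i), (t ∈ glue D P ↔ t ∈ P i) ∧ (conj D t ∈ glue D P ↔ conj D t ∈ P i) := by
    intro t ht
    exact ⟨mem_glue hG P hP i t (g_block_mem hG i t ht).1, mem_glue hG P hP i (conj D t) (g_block_mem hG i t ht).2⟩
  unfold PairsOn CosetOn ConjCosetOn at htri ⊢
  rcases htri with h | h | h
  · left; intro t ht; rw [(key t ht).1, (key t ht).2]; exact h t ht
  · right; left; intro t ht; rw [(key t ht).1, (key t ht).2]; exact h t ht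
  · right; right; intro t ht; rw [(key t ht).1, (key t ht).2]; exact h t ht

omit hF in
/-- `glue ∘ cut = id` on balanced sets. -/
theorem glue_cut (S : Finset ℕ) (hS : S ∈ balancedSets D) : glue D (cut D S) = S := by
  have hSU : S ⊆ U D := Finset.mem_powerset.mp (Finset.mem_filter.mp hS).1
  ext t
  unfold glue cut
  rw [Finset.mem_biUnion]
  constructor
  · rintro ⟨i, _, hi⟩; exact (Finset.mem_inter.mp hi).1
  · intro ht
    obtain ⟨i, hi⟩ := g_block_cover hG t (List.mem_toFinset.mp (hSU ht))
    exact ⟨i, Finset.mem_univ i, Finset.mem_inter.mpr ⟨ht, hi⟩⟩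

omit hF in
/-- `cut ∘ glue = id` on tuples of allowed pieces. -/
theorem cut_glue (P : Fin D.creps.length → Finset ℕ) (hP : P ∈ pieces D) : cut D (glue D P) = P := by
  have hPi : ∀ i, P i ⊆ block D (crep D i) := fun i =>
    Finset.mem_powerset.mp (Finset.mem_filter.mp (Fintype.mem_piFinset.mp hP i)).1
  funext i
  ext t
  unfold cut
  rw [Finset.mem_inter]
  constructor
  · rintro ⟨h1, h2⟩; exact (mem_glue hG P hP i t h2).mp h1
  · intro h; exact ⟨(mem_glue hG P hP i t (hPi i h)).mpr h, hPi i h⟩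

/-- THE COUNT: the balanced subsets of `U` number `∏_i |allowed (crep i)|`. -/
theorem card_balanced : (balancedSets D).card = ∏ i : Fin D.creps.length, (allowed D (crep D i)).card := by
  rw [Finset.card_nbij' (cut D) (glue D) (cut_mem hF hG) (glue_mem hF hG) (glue_cut hG) (cut_glue hG)]
  unfold pieces
  rw [Fintype.card_piFinset]

end

end HodgeRepro0.P5BlockCensus
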